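/-
Copyright (c) 2026. All rights reserved.
Released under Apache 2.0 license as described in the file LICENSE.
Authors: abc-iut cell, campaign-S prover seat abc-iut-S1 (gen 2).
-/
import Literature.NumberTheory.NumberFields.DifferentCompletionExponent
import Literature.NumberTheory.NumberFields.DifferentIdealIntBase
import Literature.IUT.LogVolume.DifferentLocalCriterion
import Literature.IUT.LogVolume.RescaledCompletionInvariants
import Literature.NumberTheory.GaloisRepresentations.PadicAlgebraDegreeOnePlace
import Mathlib.NumberTheory.Padics.HeightOneSpectrum
import HarnessLib

/-!
# `d_v` of the completion `F_v` equals the `v`-exponent of the global different: `d_v = ord_v(𝔇_{F/ℚ})/e_v`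

The junction between [IUTchIV] Def. 1.9 / p. 23 — `log(𝔡^F_v) := deg_{V(F)_v}(𝔡^F_ADiv)`, the `v`-component of the
arithmetic divisor of the GLOBAL different `𝔇_{𝓞F/ℤ}` (the cell's `differentDivisor F`, [GenEll] Def. 1.5 (iii)) — and
the LOCAL invariant `d_v = differentOrd p F_v` of the completion used by [IUTchIV] Props. 1.1–1.4 and Thm. 1.10 Step (v)
(«`β_e := log(𝔡^K_v) − …`», p. 28), for the completion presented as a normed `ℚ_p`-algebra of the campaign-S class
(abc-iut-S7's `RescaledCompletion F p v hv`):

* `norm_trace_padic_le_one_iff` — for `t ∈ F_v`: `‖Tr_{F_v/ℚ_p}(t)‖ ≤ 1 ⟺ Tr_{F_v/ℚ_{v₀}}(t) ∈ 𝒪_{v₀}`, `v₀ = v ∩ ℚ`, along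
  Mathlib's `ℚ_{v₀} ≃ ℚ_p` (`Rat.HeightOneSpectrum.adicCompletion.padicEquiv`; the canonical `ℚ_p → F_v` is THE continuous
  ring map, `LocalField.eq_algebraMap_adicCompletionPadicAlgebra`, so it factors through `ℚ_{v₀} → F_v`;
  Mathlib `Algebra.trace_eq_of_ringEquiv`);
* `localCondition_iff` — the local trace-dual condition of `DifferentCompletionExponent.pow_dvd_differentIdeal_iff_local`
  (over `ℚ_{v₀}`, premise on `v.asIdeal^n`) is equivalent to that of
  `DifferentLocalCriterion.pow_maximalIdeal_dvd_different_iff_trace` (over `ℚ_p`, premise on `𝔪_{F_v}^n`);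
* **`pow_dvd_differentIdeal_int_iff_div_le_differentOrd`** — `v^n ∣ 𝔇_{𝓞F/ℤ} ⟺ n/e ≤ differentOrd p F_v`; hence the
  exponent `δ_v` of `v` in the global different satisfies **`differentOrd p F_v = δ_v / e`**
  (`differentOrd_rescaledCompletion_eq`), i.e. `[F_v:ℚ_p]·d_v·log p = f_v·δ_v·log p = deg_v(𝔡^F_ADiv)`.

Serre, *Local Fields*, Ch. III §4 Prop. 10 («the different is preserved by completion»); THEOREMS ONLY; classical; the
[IUTchIV] locators record what the text prints; nothing here bears on the disputed [IUTchIII] Cor. 3.12.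
-/

noncomputable section

open scoped NumberField nonZeroDivisors NormedField

namespace Literature.IUT.LogVolume

open NumberField IsDedekindDomain IsDedekindDomain.HeightOneSpectrum IsLocalRing WithZero
  Literature.NumberTheory.NumberFields Literature.NumberTheory.GaloisRepresentations

variable (F : Type) [Field F] [NumberField F] (p : ℕ) [Fact p.Prime]
variable (v₀ : HeightOneSpectrum (𝓞 ℚ))
variable (w : v₀.Extension (𝓞 F)) (hw : ((p : ℕ) : 𝓞 F) ∈ w.1.asIdeal)

/-! ## 1. Traces over `ℚ_p` versus over `ℚ_{v₀}` -/

/-- The canonical `ℚ_p`-algebra map `ℚ_p → F_w` (`LocalField.adicCompletionPadicAlgebra`, the unique continuous ring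
homomorphism) is the local base-change map `ℚ_{v₀} → F_w` of the adelic base-change packet precomposed with Mathlib's
`ℚ_{v₀} ≃ ℚ_p` — stated after identifying `p` with the prime under `v₀` (`primesEquiv v₀`).
[cite: SerreLocalFields1979, Ch. III §4 Prop. 10] -/
theorem algebraMap_padic_comp_padicEquiv
    (hq : ((Rat.HeightOneSpectrum.primesEquiv v₀ : ℕ) : 𝓞 F) ∈ w.1.asIdeal) :
    haveI : Fact (Nat.Prime (Rat.HeightOneSpectrum.primesEquiv v₀ : ℕ)) := ⟨(Rat.HeightOneSpectrum.primesEquiv v₀).2⟩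
    letI := LocalField.adicCompletionPadicAlgebra w.1 _ hq
    (algebraMap ℚ_[(Rat.HeightOneSpectrum.primesEquiv v₀ : ℕ)] (w.1.adicCompletion F)).comp
        (Rat.HeightOneSpectrum.adicCompletion.padicEquiv v₀ :
          v₀.adicCompletion ℚ ≃+* ℚ_[(Rat.HeightOneSpectrum.primesEquiv v₀ : ℕ)]).toRingHom =
      algebraMap (v₀.adicCompletion ℚ) (w.1.adicCompletion F) := by
  haveI : Fact (Nat.Prime (Rat.HeightOneSpectrum.primesEquiv v₀ : ℕ)) := ⟨(Rat.HeightOneSpectrum.primesEquiv v₀).2⟩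
  letI := LocalField.adicCompletionPadicAlgebra w.1 _ hq
  set e := (Rat.HeightOneSpectrum.adicCompletion.padicEquiv v₀ :
    v₀.adicCompletion ℚ ≃+* ℚ_[(Rat.HeightOneSpectrum.primesEquiv v₀ : ℕ)]) with he
  -- the composite `ℚ_p → ℚ_{v₀} → F_w` is continuous, hence the canonical map
  have hcont : Continuous ((algebraMap (v₀.adicCompletion ℚ) (w.1.adicCompletion F)).comp e.symm.toRingHom) := by
    have h1 : Continuous (algebraMap (v₀.adicCompletion ℚ) (w.1.adicCompletion F)) :=
      (continuous_algebraMap_iff_smul _ _).mpr continuous_smul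
    exact h1.comp (Rat.HeightOneSpectrum.adicCompletion.padicEquiv v₀).symm.continuous
  have hφ := LocalField.eq_algebraMap_adicCompletionPadicAlgebra w.1 _ hq _ hcont
  rw [← hφ]
  refine RingHom.ext fun x ↦ ?_
  simp only [RingHom.coe_comp, Function.comp_apply]
  exact congrArg _ (e.symm_apply_apply x)

/-- **Traces over `ℚ_p` versus over `ℚ_{v₀}`** (`p ∈ v₀`): for `t ∈ F_w`, `Tr_{F_w/ℚ_p}(t)` is the image of
`Tr_{F_w/ℚ_{v₀}}(t)` under `ℚ_{v₀} ≃ ℚ_p` (Mathlib `Algebra.trace_eq_of_ringEquiv`), so `‖Tr_{F_w/ℚ_p}(t)‖ ≤ 1 ⟺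
Tr_{F_w/ℚ_{v₀}}(t) ∈ 𝒪_{v₀}` (`padicEquiv` maps `𝒪_{v₀}` onto `ℤ_p`). [cite: SerreLocalFields1979, Ch. III §4 Prop. 10] -/
theorem norm_trace_padic_le_one_iff (hv₀ : ((p : ℕ) : 𝓞 ℚ) ∈ v₀.asIdeal) (t : w.1.adicCompletion F) :
    letI := LocalField.adicCompletionPadicAlgebra w.1 p hw
    ‖Algebra.trace ℚ_[p] (w.1.adicCompletion F) t‖ ≤ 1 ↔
      Algebra.trace (v₀.adicCompletion ℚ) (w.1.adicCompletion F) t ∈ v₀.adicCompletionIntegers ℚ := by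
  obtain hp := LocalField.primesEquiv_eq_of_natCast_mem p v₀ hv₀
  subst hp
  letI := LocalField.adicCompletionPadicAlgebra w.1 _ hw
  have htr := Algebra.trace_eq_of_ringEquiv
    (Rat.HeightOneSpectrum.adicCompletion.padicEquiv v₀ :
      v₀.adicCompletion ℚ ≃+* ℚ_[(Rat.HeightOneSpectrum.primesEquiv v₀ : ℕ)])
    (algebraMap_padic_comp_padicEquiv F v₀ w hw) t
  rw [← htr]
  have hbij := Rat.HeightOneSpectrum.adicCompletion.padicEquiv_bijOn v₀
  constructor
  · intro h
    obtain ⟨s, hs, hse⟩ := hbij.2.2 ((PadicInt.mem_subring_iff _).mpr h)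
    have : s = Algebra.trace (v₀.adicCompletion ℚ) (w.1.adicCompletion F) t :=
      (Rat.HeightOneSpectrum.adicCompletion.padicEquiv v₀).injective hse
    rw [← this]
    exact hs
  · intro h
    exact (PadicInt.mem_subring_iff _).mp (hbij.1 h)

/-! ## 2. The premises: `z·𝔓^n ⊆ 𝒪_w` (global ideal) versus `z·𝔪^n ⊆ 𝒪` (local ideal of the rescaled completion) -/

/-- Elements of `𝔓^n ⊆ 𝓞 F` have `w`-adic valuation `≤ exp(−n)` in `F_w`. [folklore] -/
private theorem valued_algebraMap_le_of_mem_pow {n : ℕ} {b : 𝓞 F} (hb : b ∈ w.1.asIdeal ^ n) :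
    Valued.v (algebraMap (𝓞 F) (w.1.adicCompletion F) b) ≤ exp (-(n : ℤ)) := by
  rw [IsScalarTower.algebraMap_apply (𝓞 F) F (w.1.adicCompletion F)]
  change Valued.v (((b : 𝓞 F) : F) : w.1.adicCompletion F) ≤ _
  rw [valuedAdicCompletion_eq_valuation', valuation_of_algebraMap]
  exact (intValuation_le_pow_iff_mem w.1 b n).mpr hb

/-- **The global premise in valuative form**: `z·𝔓^n ⊆ 𝒪_w` iff `v_w(z) ≤ exp(n)` (test against `π^n` for a
uniformizer `π ∈ 𝔓` of `𝓞 F`). [cite: SerreLocalFields1979, Ch. III §4 Prop. 10] -/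
theorem forall_mul_mem_integers_iff_valued_le (n : ℕ) (z : w.1.adicCompletion F) :
    (∀ b ∈ w.1.asIdeal ^ n,
        algebraMap (𝓞 F) (w.1.adicCompletion F) b * z ∈ w.1.adicCompletionIntegers F) ↔
      Valued.v z ≤ exp (n : ℤ) := by
  constructor
  · intro hz
    obtain ⟨π, hπ⟩ := w.1.intValuation_exists_uniformizer
    have hπmem : π ∈ w.1.asIdeal := by
      rw [← intValuation_lt_one_iff_mem, hπ, ← exp_zero, exp_lt_exp]; norm_num
    have h1 := hz (π ^ n) (Ideal.pow_mem_pow hπmem n)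
    rw [mem_adicCompletionIntegers] at h1
    simp only [map_mul, map_pow] at h1
    have hvπ : Valued.v (algebraMap (𝓞 F) (w.1.adicCompletion F) π) = exp (-1 : ℤ) := by
      rw [IsScalarTower.algebraMap_apply (𝓞 F) F (w.1.adicCompletion F)]
      change Valued.v (((π : 𝓞 F) : F) : w.1.adicCompletion F) = _
      rw [valuedAdicCompletion_eq_valuation', valuation_of_algebraMap, hπ]
    rw [hvπ, ← exp_nsmul] at h1
    have h2 : exp ((n : ℤ)) * (exp (n • (-1 : ℤ)) * Valued.v z) ≤ exp (n : ℤ) * 1 := mul_le_mul' le_rfl h1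
    rwa [mul_one, ← mul_assoc, ← exp_add, smul_neg, nsmul_one, add_neg_cancel, exp_zero, one_mul] at h2
  · intro hz b hb
    rw [mem_adicCompletionIntegers, map_mul]
    have h3 : Valued.v (algebraMap (𝓞 F) (w.1.adicCompletion F) b) * Valued.v z ≤ exp (-(n : ℤ)) * exp (n : ℤ) :=
      mul_le_mul' (valued_algebraMap_le_of_mem_pow F v₀ w hb) hz
    rwa [← exp_add, neg_add_cancel, exp_zero] at h3

omit [Fact (Nat.Prime p)] in
/-- Integers of `F_w` versus the unit ball of the rescaled completion (same set). [folklore] -/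
private theorem mem_integers_iff_norm_le_one (y : w.1.adicCompletion F) :
    y ∈ w.1.adicCompletionIntegers F ↔ ‖RescaledCompletion.of F p w.1 hw y‖ ≤ 1 := by
  rw [mem_adicCompletionIntegers, Valued.toNormedField.norm_le_one_iff]
  rfl

/-- **`v_w(z) ≤ exp(n)` iff `‖z‖' ≤ p^{n/e(w|p)}`** in the rescaled norm (`‖·‖' = p^{−ord_w(·)/e(w|p)}`: a uniformizer has
rescaled norm `𝐍(w)^{−1/n_w} = p^{−1/e}`). [cite: NeukirchANT1999, Ch. II Prop. (6.8)] -/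
theorem valued_le_exp_iff_norm_le (n : ℕ) (z : w.1.adicCompletion F) :
    Valued.v z ≤ exp (n : ℤ) ↔
      ‖RescaledCompletion.of F p w.1 hw z‖ ≤ (p : ℝ) ^ ((n : ℝ) / (w.1.asIdeal.ramificationIdx ℤ : ℝ)) := by
  -- a uniformizer `π ∈ 𝔓` of `𝓞 F`, its inverse `ρ` in `F_w` (valuation `exp 1`), and `ρ^n`
  obtain ⟨π, hπ⟩ := w.1.intValuation_exists_uniformizer
  have hvπ : Valued.v (algebraMap (𝓞 F) (w.1.adicCompletion F) π) = exp (-1 : ℤ) := by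
    rw [IsScalarTower.algebraMap_apply (𝓞 F) F (w.1.adicCompletion F)]
    change Valued.v (((π : 𝓞 F) : F) : w.1.adicCompletion F) = _
    rw [valuedAdicCompletion_eq_valuation', valuation_of_algebraMap, hπ]
  have hπ0 : algebraMap (𝓞 F) (w.1.adicCompletion F) π ≠ 0 := by
    intro h0
    have : Valued.v (algebraMap (𝓞 F) (w.1.adicCompletion F) π) = 0 := by rw [h0, map_zero]
    rw [hvπ] at this
    exact exp_ne_zero this
  set ρ : w.1.adicCompletion F := (algebraMap (𝓞 F) (w.1.adicCompletion F) π)⁻¹ with hρ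
  have hvρ : Valued.v ρ = exp (1 : ℤ) := by
    rw [hρ, map_inv₀, hvπ, ← exp_neg, neg_neg]
  have hvρn : Valued.v (ρ ^ n) = exp (n : ℤ) := by
    rw [map_pow, hvρ, ← exp_nsmul, nsmul_one]
  -- its Mathlib norm `𝐍(w)^n` and rescaled norm `p^{n/e}`
  have hnorm : ‖ρ ^ n‖ = ((Ideal.absNorm w.1.asIdeal : ℕ) : ℝ) ^ (n : ℤ) :=
    Ultrametric.AdicCompletion.norm_eq_absNorm_zpow F w.1 (n : ℤ) (by rw [hvρn]; rfl)
  have hp : (0 : ℝ) < p := by exact_mod_cast (Fact.out : p.Prime).pos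
  have he : (w.1.asIdeal.ramificationIdx ℤ : ℝ) ≠ 0 := by exact_mod_cast (Ideal.ramificationIdx_pos _ _).ne'
  have hf : (w.1.asIdeal.inertiaDeg ℤ : ℝ) ≠ 0 := by exact_mod_cast (Ideal.inertiaDeg_pos _ _).ne'
  have hnorm' : ‖RescaledCompletion.of F p w.1 hw (ρ ^ n)‖ =
      (p : ℝ) ^ ((n : ℝ) / (w.1.asIdeal.ramificationIdx ℤ : ℝ)) := by
    rw [RescaledCompletion.norm_of, hnorm, absNorm_eq_pow_inertiaDeg F p w.1 hw, localDeg]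
    push_cast
    rw [← Real.rpow_natCast, ← Real.rpow_intCast, ← Real.rpow_mul hp.le, ← Real.rpow_mul hp.le]
    congr 1
    field_simp
    norm_cast
  -- compare through the reference element
  rw [← hvρn, ← hnorm']
  exact (Valued.toNormedField.norm_le_iff (x := RescaledCompletion.of F p w.1 hw z)
    (x' := RescaledCompletion.of F p w.1 hw (ρ ^ n))).symm

/-! ## 3. In the campaign-S class: the `𝔪^n`-premise as a norm bound; the conditions agree -/

section Generic

variable (K : Type*) [NontriviallyNormedField K] [NormedAlgebra ℚ_[p] K] [IsUltrametricDist K] [ProperSpace K]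

/-- For `K` of the MLF class: `‖b·z‖ ≤ 1` for all `b ∈ 𝔪_K^n` iff `‖z‖ ≤ p^{n/e_K}` (`𝔪_K^n = {‖·‖ ≤ p^{−n/e_K}}`,
`coe_maximalIdeal_pow_eq_pBall`, and a uniformizer power has norm exactly `p^{−n/e_K}`).
[cite: Mochizuki2012, IUTchIV Prop. 1.1 p. 9] -/
theorem forall_norm_mul_le_one_iff_norm_le (n : ℕ) (z : K) :
    (∀ b ∈ maximalIdeal (Valued.integer K) ^ n, ‖(b : K) * z‖ ≤ 1) ↔
      ‖z‖ ≤ (p : ℝ) ^ ((n : ℝ) / (absRamificationIdx p K : ℝ)) := by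
  have hp : (0 : ℝ) < p := by exact_mod_cast (Fact.out : p.Prime).pos
  have hball := coe_maximalIdeal_pow_eq_pBall p K n
  have hmem : ∀ b : Valued.integer K, b ∈ maximalIdeal (Valued.integer K) ^ n ↔
      ‖(b : K)‖ ≤ (p : ℝ) ^ (-((n : ℝ) / (absRamificationIdx p K : ℝ))) := by
    intro b
    rw [← mem_pBall_iff (p := p), ← hball]
    exact ⟨fun h ↦ ⟨b, h, rfl⟩, fun ⟨b', hb', hbb'⟩ ↦ by rwa [← Subtype.ext hbb']⟩
  constructor
  · intro h
    obtain ⟨ϖ₀, hirr⟩ := IsDiscreteValuationRing.exists_irreducible (Valued.integer K)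
    have hϖn : ‖((ϖ₀ ^ n : Valued.integer K) : K)‖ = (p : ℝ) ^ (-((n : ℝ) / (absRamificationIdx p K : ℝ))) := by
      rw [SubmonoidClass.coe_pow, norm_pow, norm_irreducible_eq p K hirr, ← Real.rpow_natCast,
        ← Real.rpow_mul hp.le]
      congr 1
      ring
    have h1 := h (ϖ₀ ^ n) ((hmem _).mpr hϖn.le)
    rw [norm_mul, hϖn] at h1
    have h2 : (p : ℝ) ^ ((n : ℝ) / (absRamificationIdx p K : ℝ)) *
        ((p : ℝ) ^ (-((n : ℝ) / (absRamificationIdx p K : ℝ))) * ‖z‖) ≤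
        (p : ℝ) ^ ((n : ℝ) / (absRamificationIdx p K : ℝ)) * 1 :=
      mul_le_mul_of_nonneg_left h1 (Real.rpow_nonneg hp.le _)
    rwa [mul_one, ← mul_assoc, ← Real.rpow_add hp, add_neg_cancel, Real.rpow_zero, one_mul] at h2
  · intro h b hb
    rw [norm_mul]
    have hb' := (hmem b).mp hb
    calc ‖(b : K)‖ * ‖z‖ ≤ (p : ℝ) ^ (-((n : ℝ) / (absRamificationIdx p K : ℝ))) *
        (p : ℝ) ^ ((n : ℝ) / (absRamificationIdx p K : ℝ)) :=
          mul_le_mul hb' h (norm_nonneg _) (Real.rpow_nonneg hp.le _)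
      _ = 1 := by rw [← Real.rpow_add hp, neg_add_cancel, Real.rpow_zero]

/-- **`n/e_K ≤ d` through a norm bound** (`div_le_differentOrd_iff_trace` with the premise rewritten):
`n/e_K ≤ differentOrd p K` iff every `z` with `‖z‖ ≤ p^{n/e_K}` pairs the unit ball into `ℤ_p` under the trace form.
[cite: SerreLocalFields1979, Ch. III §4 Prop. 10] -/
theorem div_le_differentOrd_iff_norm (n : ℕ) :
    (n : ℝ) / absRamificationIdx p K ≤ differentOrd p K ↔
      ∀ z : K, ‖z‖ ≤ (p : ℝ) ^ ((n : ℝ) / (absRamificationIdx p K : ℝ)) →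
        ∀ y : K, ‖y‖ ≤ 1 → ‖Algebra.trace ℚ_[p] K (z * y)‖ ≤ 1 := by
  rw [div_le_differentOrd_iff_trace p K n]
  refine forall_congr' fun z ↦ ?_
  rw [forall_norm_mul_le_one_iff_norm_le p K n z]

end Generic

/-- **The two local codifferent conditions agree**: the condition of `pow_dvd_differentIdeal_iff_local` at `w`
(traces to `ℚ_{v₀}`, premise `z·𝔓^n ⊆ 𝒪_w`) is equivalent to the norm-form condition over `ℚ_p` on the rescaled
completion (premise `‖z‖' ≤ p^{n/e(w|p)}`). [cite: SerreLocalFields1979, Ch. III §4 Prop. 10] -/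
theorem localCondition_iff (hv₀ : ((p : ℕ) : 𝓞 ℚ) ∈ v₀.asIdeal) (n : ℕ) :
    (∀ z : w.1.adicCompletion F,
        (∀ b ∈ w.1.asIdeal ^ n, algebraMap (𝓞 F) (w.1.adicCompletion F) b * z ∈ w.1.adicCompletionIntegers F) →
          ∀ y ∈ w.1.adicCompletionIntegers F,
            Algebra.trace (v₀.adicCompletion ℚ) (w.1.adicCompletion F) (z * y) ∈ v₀.adicCompletionIntegers ℚ) ↔
      ∀ z : RescaledCompletion F p w.1 hw,
        ‖z‖ ≤ (p : ℝ) ^ ((n : ℝ) / (w.1.asIdeal.ramificationIdx ℤ : ℝ)) →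
          ∀ y : RescaledCompletion F p w.1 hw, ‖y‖ ≤ 1 →
            ‖Algebra.trace ℚ_[p] (RescaledCompletion F p w.1 hw) (z * y)‖ ≤ 1 := by
  constructor
  · intro h z hz y hy
    have hz' : Valued.v ((RescaledCompletion.of F p w.1 hw).symm z) ≤ exp (n : ℤ) :=
      (valued_le_exp_iff_norm_le F p v₀ w hw n _).mpr hz
    have hy' : (RescaledCompletion.of F p w.1 hw).symm y ∈ w.1.adicCompletionIntegers F :=
      (mem_integers_iff_norm_le_one F p v₀ w hw _).mpr hy
    have := h ((RescaledCompletion.of F p w.1 hw).symm z)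
      ((forall_mul_mem_integers_iff_valued_le F v₀ w n _).mpr hz') _ hy'
    exact (norm_trace_padic_le_one_iff F p v₀ w hw hv₀ _).mpr this
  · intro h z hz y hy
    have hz' : ‖RescaledCompletion.of F p w.1 hw z‖ ≤ (p : ℝ) ^ ((n : ℝ) / (w.1.asIdeal.ramificationIdx ℤ : ℝ)) :=
      (valued_le_exp_iff_norm_le F p v₀ w hw n z).mp ((forall_mul_mem_integers_iff_valued_le F v₀ w n z).mp hz)
    have hy' : ‖RescaledCompletion.of F p w.1 hw y‖ ≤ 1 := (mem_integers_iff_norm_le_one F p v₀ w hw y).mp hy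
    have := h (RescaledCompletion.of F p w.1 hw z) hz' _ hy'
    exact (norm_trace_padic_le_one_iff F p v₀ w hw hv₀ (z * y)).mp this

/-- **`𝔓^n ∣ 𝔇_{𝓞F/ℤ} ⟺ n/e(𝔓|p) ≤ d_𝔓`**, where `d_𝔓 = differentOrd p F_𝔓` is the normalised order of the different of
the completion (rescaled presentation): the exponent of `𝔓` in the GLOBAL different is read off the LOCAL different of
`F_𝔓/ℚ_p` — Serre III §4 Prop. 10 in the form consumed by [IUTchIV] (Def. 1.9's `log(𝔡^F_𝔓)` versus Prop. 1.1's `d`).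
[cite: SerreLocalFields1979, Ch. III §4 Prop. 10] -/
theorem pow_dvd_differentIdeal_int_iff_div_le_differentOrd (hv₀ : ((p : ℕ) : 𝓞 ℚ) ∈ v₀.asIdeal) (n : ℕ) :
    w.1.asIdeal ^ n ∣ differentIdeal ℤ (𝓞 F) ↔
      (n : ℝ) / absRamificationIdx p (RescaledCompletion F p w.1 hw) ≤ differentOrd p (RescaledCompletion F p w.1 hw) := by
  rw [differentIdeal_int_eq_differentIdeal_ringOfIntegers_rat F, div_le_differentOrd_iff_norm,
    absRamificationIdx_rescaledCompletion]
  exact (pow_dvd_differentIdeal_iff_local ℚ F v₀ w n).trans (localCondition_iff F p v₀ w hw hv₀ n)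

/-- **`d_𝔓 = δ_𝔓 / e(𝔓|p)`**: the normalised different order of the completion `F_𝔓` (rescaled presentation; `d_i` of
[IUTchIV] Prop. 1.1, p. 9) equals the exponent `δ_𝔓` of `𝔓` in the global different `𝔇_{𝓞F/ℤ}` divided by the
ramification index `e(𝔓|p)` — for the unique `δ` with `𝔓^δ ∥ 𝔇`. [cite: Mochizuki2012, IUTchIV Def. 1.9 p. 21] -/
theorem differentOrd_rescaledCompletion_eq (hv₀ : ((p : ℕ) : 𝓞 ℚ) ∈ v₀.asIdeal) {δ : ℕ}
    (hδ : w.1.asIdeal ^ δ ∣ differentIdeal ℤ (𝓞 F)) (hδ' : ¬ w.1.asIdeal ^ (δ + 1) ∣ differentIdeal ℤ (𝓞 F)) :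
    differentOrd p (RescaledCompletion F p w.1 hw) = (δ : ℝ) / (w.1.asIdeal.ramificationIdx ℤ : ℝ) := by
  obtain ⟨δ₀, hδ₀, hd⟩ := exists_different_eq_maximalIdeal_pow p (RescaledCompletion F p w.1 hw)
  rw [absRamificationIdx_rescaledCompletion] at hd
  rw [hd]
  have h1 := (pow_dvd_differentIdeal_int_iff_div_le_differentOrd F p v₀ w hw hv₀ δ).mp hδ
  have h2 := (pow_dvd_differentIdeal_int_iff_div_le_differentOrd F p v₀ w hw hv₀ (δ + 1)).not.mp hδ'
  rw [absRamificationIdx_rescaledCompletion, hd] at h1 h2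
  have he : (0 : ℝ) < (w.1.asIdeal.ramificationIdx ℤ : ℝ) := by exact_mod_cast Ideal.ramificationIdx_pos _ _
  rw [div_le_div_iff_of_pos_right he, Nat.cast_le] at h1
  rw [div_le_div_iff_of_pos_right he, not_le, Nat.cast_lt] at h2
  congr 1
  norm_cast
  omega

end Literature.IUT.LogVolume

end
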